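import Summits.Ventures.HSemireg.WedgeHankelRecurrenceGaussChebyshevIntegrals

/-!
# Venture HSemireg — **THE DIFFERENTIAL EQUATIONS OF THE VIETA–LUCAS POLYNOMIALS IN EVERY COMMUTATIVE RING: `(4 − X²)C_n″ − X·C_n′ + n²C_n = 0` and `(4 − X²)S_n″ − 3X·S_n′ + n(n+2)S_n = 0`**
# (the `x ↦ x∕2` rescalings of Chebyshev's equations `(1 − x²)T″ − xT′ + n²T = 0`, `(1 − x²)U″ − 3xU′ + n(n+2)U = 0`, Mathlib `one_sub_X_sq_mul_derivative_derivative_T ∕ U_eq_poly_in_T ∕ U`,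
# proved here directly from the chapter's `C_n′ = nS_{n−1}` and `(4 − X²)S_n′ = 2(n+1)S_{n−1} − nXS_n`)

HONEST FRAMING. Part of the Lean index of the computation cell `pub-hsemireg` (seat p10 gen 49, Sunday typer «UNIFORM-IN-n»).  Polynomial algebra with the formal derivative (Mathlib `Polynomial.derivative`,
`Polynomial.Chebyshev.S ∕ C`) over an arbitrary commutative ring; no variety, no cohomology theory, no sheaf, no Ext group and no semiregularity map is constructed here; nothing here says that HC /
HC_CM / HC_AV holds; no Literature fact (unproved `Prop`) is declared or used.  Custodian versions as in `WedgeHankelSiegelIdeal` (1/3).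
SOURCES (cited).  G. Szegő, *Orthogonal Polynomials* (AMS 1939/1975), (4.7.x) ∕ §4.21 (the hypergeometric equation of the Jacobi ∕ Chebyshev polynomials); NIST DLMF §18.8 (Table 18.8.1: `T_n`, `U_n`
rows); T. J. Rivlin, *The Chebyshev Polynomials* (Wiley 1974), (1.36).
PROOF TYPED HERE.  (1) `C_n″ = n·S_{n−1}′` (N510 `chebyshevC_derivative_eq_S`, `derivative_intCast`), `(4 − X²)S_{n−1}′ = 2nS_{n−2} − (n−1)XS_{n−1}` (N471 `four_sub_X_sq_mul_derivative_S`),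
`C_n = S_n − S_{n−2}` (N535 `chebyshevC_add_two_eq_S_sub_S`) and `S_n = XS_{n−1} − S_{n−2}` (Mathlib `S_add_two`) combine by `linear_combination`; (2) differentiating (1) for `C_{n+1}` and
substituting `C_{n+1}′ = (n+1)S_n` gives `(n+1)·[(4 − X²)S_n″ − 3XS_n′ + n(n+2)S_n] = 0`; over `ℤ[X]` (a domain) the factor `n + 1 ≠ 0` cancels (`n = −1`: `S_{−1} = 0`), and the identity is mapped to
every commutative ring along `Polynomial.map (Int.castRingHom R)` (`map_S`, `derivative_map`).
DEDUP DISCLOSURE (`rg -n 'derivative \\(derivative \\(Polynomial.Chebyshev.(C|S)|4 - Polynomial.X \\^ 2' Summits/Ventures/HSemireg`, 2026-09-04): N471 has the FIRST-order identities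
`four_sub_X_sq_mul_derivative_S ∕ _C`, N513 the value `C_n″(2)`; Mathlib has the `T ∕ U` second-order equations (`one_sub_X_sq_mul_derivative_derivative_T_eq_poly_in_T`,
`one_sub_X_sq_mul_derivative_derivative_U_eq_poly_in_U`); the `C ∕ S` second-order equations are not typed; 0 hits for the 3 names below.

WHAT IS IN THE TREE.  N510 `chebyshevC_derivative_eq_S`; N471 `four_sub_X_sq_mul_derivative_S`; N535 `chebyshevC_add_two_eq_S_sub_S`; Mathlib `S_add_two`, `S_neg_one`, `map_S`, `derivative_map`,
`derivative_mul`, `derivative_intCast`, `derivative_X`, `derivative_X_pow`, `mul_left_cancel₀`.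
THIS FILE (namespace `Summit.Ventures.HSemireg.Wedge.HankelOuter` continued; CHAINED on N535; 0 definitions):
* §1301 **`four_sub_X_sq_mul_derivative_derivative_C`** (`(4 − X²)C_n″ = X·C_n′ − n²C_n`, all `n ∈ ℤ`, every commutative ring), `four_sub_X_sq_mul_derivative_derivative_S_int` (the `S`-equation over
  `ℤ`), **`four_sub_X_sq_mul_derivative_derivative_S`** (`(4 − X²)S_n″ = 3X·S_n′ − n(n+2)S_n`, all `n ∈ ℤ`, every commutative ring).
CAVEATS.  Integer casts `(n : R[X])`.  Nothing Ext-side.  New names only.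
-/

open Module Polynomial
open scoped Matrix Polynomial

namespace Summit.Ventures.HSemireg.Wedge.HankelOuter

/-! ## §1301. `(4 − X²)C_n″ − XC_n′ + n²C_n = 0`, `(4 − X²)S_n″ − 3XS_n′ + n(n+2)S_n = 0` -/

/-- **`(4 − X²)·C_n″ = X·C_n′ − n²·C_n`** for all `n ∈ ℤ`, in every commutative ring (Chebyshev's equation for `T_n` rescaled by `x ↦ x∕2`). [Szegő §4.21; DLMF 18.8.1; this file, §1301] -/
theorem four_sub_X_sq_mul_derivative_derivative_C (R : Type*) [CommRing R] (n : ℤ) :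
    (4 - Polynomial.X ^ 2) * derivative (derivative (Polynomial.Chebyshev.C R n)) =
      Polynomial.X * derivative (Polynomial.Chebyshev.C R n) - (n : R[X]) ^ 2 * Polynomial.Chebyshev.C R n := by
  have h1 := four_sub_X_sq_mul_derivative_S R (n - 1)
  rw [show n - 1 - 1 = n - 2 by ring] at h1
  have h2 := Polynomial.Chebyshev.S_add_two R (n - 2)
  rw [show n - 2 + 2 = n by ring, show n - 2 + 1 = n - 1 by ring] at h2
  have h3 := chebyshevC_add_two_eq_S_sub_S R (n - 2)
  rw [show n - 2 + 2 = n by ring] at h3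
  rw [chebyshevC_derivative_eq_S, derivative_mul, derivative_intCast, zero_mul, zero_add]
  linear_combination (norm := (push_cast; ring_nf)) (n : R[X]) * h1 + (n : R[X]) ^ 2 * h3 + (n : R[X]) ^ 2 * h2

/-- The `S`-equation over `ℤ`: `(4 − X²)·S_n″ = 3X·S_n′ − n(n+2)·S_n` (differentiate the `C_{n+1}`-equation, substitute `C_{n+1}′ = (n+1)S_n`, cancel `n + 1` in the domain `ℤ[X]`; `S_{−1} = 0`).
[Szegő §4.21; DLMF 18.8.1; this file, §1301] -/
theorem four_sub_X_sq_mul_derivative_derivative_S_int (n : ℤ) :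
    (4 - Polynomial.X ^ 2) * derivative (derivative (Polynomial.Chebyshev.S ℤ n)) =
      3 * Polynomial.X * derivative (Polynomial.Chebyshev.S ℤ n) - ((n + 2) * n : ℤ[X]) * Polynomial.Chebyshev.S ℤ n := by
  rcases eq_or_ne n (-1) with rfl | hn
  · simp [Polynomial.Chebyshev.S_neg_one]
  · have hne : ((n + 1 : ℤ) : ℤ[X]) ≠ 0 := by
      rw [Ne, Int.cast_eq_zero]
      omega
    have hC := congrArg derivative (four_sub_X_sq_mul_derivative_derivative_C ℤ (n + 1))
    have hd : derivative (Polynomial.Chebyshev.C ℤ (n + 1)) = ((n + 1 : ℤ) : ℤ[X]) * Polynomial.Chebyshev.S ℤ n := by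
      rw [chebyshevC_derivative_eq_S, add_sub_cancel_right, Int.cast_add, Int.cast_one]
    simp only [derivative_mul, derivative_sub, derivative_X, derivative_ofNat, derivative_intCast, derivative_pow, hd, zero_mul, zero_add, zero_sub, mul_zero, map_natCast] at hC
    apply mul_left_cancel₀ hne
    linear_combination (norm := (push_cast; ring_nf)) hC

/-- **`(4 − X²)·S_n″ = 3X·S_n′ − n(n+2)·S_n`** for all `n ∈ ℤ`, in every commutative ring (Chebyshev's equation for `U_n` rescaled by `x ↦ x∕2`; base-changed from `ℤ`).
[Szegő §4.21; DLMF 18.8.1; this file, §1301] -/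
theorem four_sub_X_sq_mul_derivative_derivative_S (R : Type*) [CommRing R] (n : ℤ) :
    (4 - Polynomial.X ^ 2) * derivative (derivative (Polynomial.Chebyshev.S R n)) =
      3 * Polynomial.X * derivative (Polynomial.Chebyshev.S R n) - ((n + 2) * n : R[X]) * Polynomial.Chebyshev.S R n := by
  have h := congrArg (Polynomial.map (Int.castRingHom R)) (four_sub_X_sq_mul_derivative_derivative_S_int n)
  simp only [Polynomial.map_mul, Polynomial.map_sub, Polynomial.map_pow, Polynomial.map_ofNat, Polynomial.map_X, ← Polynomial.derivative_map, Polynomial.Chebyshev.map_S,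
    Polynomial.map_add, Polynomial.map_intCast] at h
  exact h

end Summit.Ventures.HSemireg.Wedge.HankelOuter
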